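import Literature.Combinatorics.Digraph.EulerianSandpileGroup
import HarnessLib

/-!
# The bidirected digraph of a simple graph: Eulerian, `t⁻ =` number of spanning trees, bidirected
# Euler tours by BEST, and its sandpile group is the critical group

Topic `Literature/Combinatorics/Digraph`, namespace `Literature.Combinatorics.Digraph.Multidigraph`.
Lane `lit-hodgefound`, seat p23, generation 45, row g45-#20 of the programme «Eulerian cycles in
directed multigraphs: arborescences, the BEST theorem and its corollaries» — the bridge from the
directed theory (`MultidigraphArborescences` … `EulerianSandpileGroup`) back to the tree's simple
graphs (`SimpleGraph/MatrixTreeTheorem`, `SimpleGraph/CriticalGroup`).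

## Source, verbatim

A. E. Holroyd, L. Levine, K. Mészáros, Y. Peres, J. Propp, D. B. Wilson, *Chip-firing and
rotor-routing on directed graphs* (2008) [HolroydEtAl2008], §4 (held text `paper:arxiv-0801.3306`,
chunk p0013): «A digraph `G = (E, V)` is Eulerian if it is strongly connected, and for each vertex
`v ∈ V` the in-degree and the out-degree of `v` are equal. […] Note that for any connected undirected
graph, the corresponding bidirected graph is Eulerian.»; §2 (chunk p0005) Definition 2.7 / Lemma 2.8
(the sandpile group `ℤ^{n−1}/ℤ^{n−1}Δ'` and its order `det Δ'`); Corollary 4.10 (chunk p0015):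
«Let `G = (V, E)` be an Eulerian digraph. Fix an edge `e ∈ E` and let `tail(e) = w`. Let `𝒯(G, v)`
denote the number of oriented spanning trees in `G` rooted at `w`, and let `ε(G, e)` be the number of
Eulerian tours in `G` starting with the edge `e`. Then `ε(G, e) = 𝒯(G, w) ∏_{v∈V} (d_v − 1)!`.»

The bidirected digraph of a simple graph `G` has the darts of `G` (Mathlib `SimpleGraph.Dart`:
ordered adjacent pairs) as arcs. Its Laplacian `Δ = D − A` is the graph Laplacian `G.lapMatrix ℤ`,
so by the two matrix-tree theorems of the tree its `t⁻(·, s)` is the number of spanning trees of `G`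
for every `s`, its Eulerian tours (closed walks traversing every edge once in each direction) are
counted by BEST, and its sink-free sandpile group `(ℤⁿ ∩ 1^⊥)/ℤⁿΔ` is literally the critical group
`(ℤⁿ ∩ 1^⊥)/𝓛(Q)` of `SimpleGraph/CriticalGroup`.

## What is here (definitions with bodies, theorems; no named fact, no instance, no notation)

* `ofSimpleGraph G : Multidigraph V G.Dart` (tail `fst`, head `snd`), `outDeg_ofSimpleGraph` /
  `inDeg_ofSimpleGraph` (`= G.degree v`: **balanced**), `adj_ofSimpleGraph_iff`,
  `reachable_ofSimpleGraph_iff` («the corresponding bidirected graph is Eulerian» for connected `G`),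
  `arcCount_ofSimpleGraph`, `laplacianInt_ofSimpleGraph` (`Δ = G.lapMatrix ℤ`).
* **`card_arborescencesTo_ofSimpleGraph`**: `t⁻(G↔, s) =` the number of spanning trees of `G`, for
  every root `s` (directed MTT `det_reducedLaplacian` meets `det_lapMatrix_int_submatrix_eq`).
* **`card_isEulerianCycle_ofSimpleGraph`** (BEST for bidirected graphs): a connected graph with all
  degrees positive has `(∏_v (deg v − 1)!) ·` #spanning trees bidirected Euler tours;
  `card_isEulerianFrom_ofSimpleGraph` (Corollary 4.10's form, tours with a fixed first dart).
* `laplacianRowLattice_ofSimpleGraph` (`ℤⁿΔ = 𝓛(Q)`), **`sandpileGroupOfSimpleGraphEquiv :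
  (ofSimpleGraph G).sandpileGroup ≃+ criticalGroup G`**, `sinkSandpileGroupOfSimpleGraphEquiv`
  (`𝒮(G↔_s) ≃+ criticalGroup G` for every sink), `card_sinkSandpileGroup_ofSimpleGraph`.

## References

* [HolroydEtAl2008] Holroyd–Levine–Mészáros–Peres–Propp–Wilson, *Chip-firing and rotor-routing on
  directed graphs*, Progr. Probab. 60 (2008), §2 Definition 2.7, Lemma 2.8; §4 and Corollary 4.10.
-/

namespace Literature.Combinatorics.Digraph

namespace Multidigraph

open Finset Function Matrix
open Literature.Combinatorics.SimpleGraph.WeightedMatrixForest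
open Literature.Combinatorics.SimpleGraph.ChipFiring
open Literature.Combinatorics.SimpleGraph.MatrixTreeTheorem

variable {V : Type*} (G : SimpleGraph V)

/-! ### §1 The bidirected digraph -/

/-- **The bidirected digraph** of a simple graph: one arc for each dart (ordered pair of adjacent
vertices), i.e. each edge in both directions. [cite: HolroydEtAl2008, §4 («the corresponding
bidirected graph»)] -/
def ofSimpleGraph : Multidigraph V G.Dart := ⟨fun d => d.fst, fun d => d.snd⟩

/-- [cite: HolroydEtAl2008, §4] -/
@[simp] theorem ofSimpleGraph_src (d : G.Dart) : (ofSimpleGraph G).src d = d.fst := rfl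

/-- [cite: HolroydEtAl2008, §4] -/
@[simp] theorem ofSimpleGraph_tgt (d : G.Dart) : (ofSimpleGraph G).tgt d = d.snd := rfl

/-- Adjacency in the bidirected digraph is adjacency in `G`. [cite: HolroydEtAl2008, §4] -/
theorem adj_ofSimpleGraph_iff (u v : V) : (ofSimpleGraph G).Adj u v ↔ G.Adj u v := by
  constructor
  · rintro ⟨d, rfl, rfl⟩
    exact d.adj
  · intro h
    exact ⟨⟨(u, v), h⟩, rfl, rfl⟩

/-- Directed reachability in the bidirected digraph is reachability in `G`; so for a connected graph
the bidirected digraph is strongly connected («… is Eulerian»). [cite: HolroydEtAl2008, §4] -/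
theorem reachable_ofSimpleGraph_iff (u v : V) : (ofSimpleGraph G).Reachable u v ↔ G.Reachable u v := by
  have h : (ofSimpleGraph G).Adj = G.Adj := by
    funext a b
    exact propext (adj_ofSimpleGraph_iff G a b)
  rw [SimpleGraph.reachable_iff_reflTransGen, Reachable, h]

variable [Fintype V] [DecidableEq V] [DecidableRel G.Adj]

/-- The out-degree in the bidirected digraph is the degree. [cite: HolroydEtAl2008, §4] -/
theorem outDeg_ofSimpleGraph (v : V) : (ofSimpleGraph G).outDeg v = G.degree v :=
  calc (ofSimpleGraph G).outDeg v = ({d : G.Dart | d.fst = v} : Finset G.Dart).card := rfl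
    _ = G.degree v := G.dart_fst_fiber_card_eq_degree v

/-- The in-degree in the bidirected digraph is the degree (reverse the darts).
[cite: HolroydEtAl2008, §4] -/
theorem inDeg_ofSimpleGraph (v : V) : (ofSimpleGraph G).inDeg v = G.degree v := by
  rw [← outDeg_ofSimpleGraph G v, inDeg, outDeg]
  refine Finset.card_bij (fun d _ => d.symm) (fun d hd => ?_) (fun d₁ _ d₂ _ h => ?_) (fun d hd => ?_)
  · rw [mem_inArcs] at hd
    rw [mem_outArcs, ofSimpleGraph_src]
    exact hd
  · exact SimpleGraph.Dart.symm_involutive.injective h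
  · refine ⟨d.symm, ?_, SimpleGraph.Dart.symm_symm d⟩
    rw [mem_outArcs] at hd
    rw [mem_inArcs, ofSimpleGraph_tgt]
    exact hd

/-- **«The corresponding bidirected graph is Eulerian»**, degree half: it is balanced.
[cite: HolroydEtAl2008, §4] -/
theorem inDeg_eq_outDeg_ofSimpleGraph (v : V) :
    (ofSimpleGraph G).inDeg v = (ofSimpleGraph G).outDeg v := by
  rw [inDeg_ofSimpleGraph, outDeg_ofSimpleGraph]

/-- At most one dart from `u` to `v`: the arc count is the adjacency indicator.
[cite: HolroydEtAl2008, §4] -/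
theorem arcCount_ofSimpleGraph (u v : V) :
    (ofSimpleGraph G).arcCount u v = if G.Adj u v then 1 else 0 := by
  rw [arcCount]
  split_ifs with h
  · rw [Finset.card_eq_one]
    refine ⟨⟨(u, v), h⟩, ?_⟩
    ext d
    simp only [mem_arcsFromTo, ofSimpleGraph_src, ofSimpleGraph_tgt, Finset.mem_singleton]
    constructor
    · rintro ⟨h1, h2⟩
      ext <;> simp [h1, h2]
    · rintro rfl
      exact ⟨rfl, rfl⟩
  · rw [Finset.card_eq_zero, Finset.eq_empty_iff_forall_notMem]
    intro d hd
    rw [mem_arcsFromTo, ofSimpleGraph_src, ofSimpleGraph_tgt] at hd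
    apply h
    rw [← hd.1, ← hd.2]
    exact d.adj

/-- **`Δ = D − A` of the bidirected digraph is the graph Laplacian `Q = G.lapMatrix ℤ`.**
[cite: HolroydEtAl2008, §2 before Definition 2.7; §4] -/
theorem laplacianInt_ofSimpleGraph : (ofSimpleGraph G).laplacianInt = G.lapMatrix ℤ := by
  rw [laplacianInt, ← wLaplacian_adj]
  congr 1
  funext u v
  rw [arcCount_ofSimpleGraph]
  split_ifs <;> simp

/-! ### §2 Arborescences of the bidirected digraph = spanning trees -/

/-- **`t⁻(G↔, s)` is the number of spanning trees of `G`, for every root `s`** (the directed and the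
undirected matrix-tree theorems compute the same minor of `Q`).
[cite: HolroydEtAl2008, Corollary 4.10 («oriented spanning trees … rooted at `w`»); §4] -/
theorem card_arborescencesTo_ofSimpleGraph (s : V) :
    ((ofSimpleGraph G).arborescencesTo s).card = Nat.card {T : SimpleGraph V // T ≤ G ∧ T.IsTree} := by
  have h1 := (ofSimpleGraph G).det_reducedLaplacian s
  rw [reducedLaplacian, laplacianInt_ofSimpleGraph, det_lapMatrix_int_submatrix_eq] at h1
  exact_mod_cast h1.symm

/-! ### §3 BEST for bidirected graphs -/

/-- **Bidirected Euler tours by BEST**: a connected simple graph with all degrees positive has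
exactly `(∏_v (deg v − 1)!) · #{spanning trees}` closed walks traversing every edge exactly once in
each direction, counted as cyclic arrangements of the darts. [cite: HolroydEtAl2008, Corollary 4.10
and §4 («the corresponding bidirected graph is Eulerian»)] -/
theorem card_isEulerianCycle_ofSimpleGraph (hconn : G.Connected) (hpos : ∀ v, 0 < G.degree v) :
    Nat.card {c : Cycle G.Dart // (ofSimpleGraph G).IsEulerianCycle c} =
      (∏ v, (G.degree v - 1).factorial) * Nat.card {T : SimpleGraph V // T ≤ G ∧ T.IsTree} := by
  haveI := hconn.nonempty
  obtain ⟨s⟩ := (inferInstance : Nonempty V)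
  rw [(ofSimpleGraph G).card_isEulerianCycle (inDeg_eq_outDeg_ofSimpleGraph G)
      (fun v => by rw [outDeg_ofSimpleGraph]; exact hpos v) s, card_arborescencesTo_ofSimpleGraph]
  congr 1
  exact Finset.prod_congr rfl fun v _ => by rw [outDeg_ofSimpleGraph]

/-- Corollary 4.10's form: the bidirected Euler tours with a fixed first dart `e` number
`𝒯(G, tail e) · ∏_v (deg v − 1)!`. [cite: HolroydEtAl2008, Corollary 4.10] -/
theorem card_isEulerianFrom_ofSimpleGraph (hpos : ∀ v, 0 < G.degree v) (e : G.Dart) :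
    Nat.card {w : Fin (Fintype.card G.Dart) ≃ G.Dart // (ofSimpleGraph G).IsEulerianFrom e w} =
      (∏ v, (G.degree v - 1).factorial) * Nat.card {T : SimpleGraph V // T ≤ G ∧ T.IsTree} := by
  rw [(ofSimpleGraph G).card_isEulerianFrom (inDeg_eq_outDeg_ofSimpleGraph G)
      (fun v => by rw [outDeg_ofSimpleGraph]; exact hpos v) e, ofSimpleGraph_src,
    card_arborescencesTo_ofSimpleGraph]
  congr 1
  exact Finset.prod_congr rfl fun v _ => by rw [outDeg_ofSimpleGraph]

/-! ### §4 The sandpile group of the bidirected digraph is the critical group -/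

/-- The row lattice `ℤⁿΔ` of the bidirected digraph is the Laplacian lattice `𝓛(Q)` of `G`
(`Q` is symmetric). [cite: HolroydEtAl2008, §2 Definition 2.7; §4] -/
theorem laplacianRowLattice_ofSimpleGraph :
    (ofSimpleGraph G).laplacianRowLattice = laplacianLattice G := by
  rw [laplacianRowLattice, laplacianInt_ofSimpleGraph, (SimpleGraph.isSymm_lapMatrix G (R := ℤ)).eq]
  rfl

/-- **The sink-free sandpile group of the bidirected digraph IS the critical group `(ℤⁿ ∩ 1^⊥)/𝓛(Q)`.**
[cite: HolroydEtAl2008, §4 (sandpiles on undirected graphs as the bidirected case)] -/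
def sandpileGroupOfSimpleGraphEquiv : (ofSimpleGraph G).sandpileGroup ≃+ criticalGroup G :=
  QuotientAddGroup.quotientAddEquivOfEq (by rw [laplacianRowLattice_ofSimpleGraph])

/-- Hence for every sink `s` the sandpile group `𝒮(G↔_s)` of Definition 2.7 is the critical group of
`G`. [cite: HolroydEtAl2008, Definition 2.7, Lemma 4.12] -/
noncomputable def sinkSandpileGroupOfSimpleGraphEquiv (s : V) :
    (ofSimpleGraph G).sinkSandpileGroup s ≃+ criticalGroup G :=
  ((ofSimpleGraph G).sinkSandpileGroupEquiv (inDeg_eq_outDeg_ofSimpleGraph G) s).trans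
    (sandpileGroupOfSimpleGraphEquiv G)

/-- … and its order is the number of spanning trees (Lemma 2.8; compare `card_criticalGroup`).
[cite: HolroydEtAl2008, Lemma 2.8] -/
theorem card_sinkSandpileGroup_ofSimpleGraph (hconn : G.Connected) (s : V) :
    Nat.card ((ofSimpleGraph G).sinkSandpileGroup s) = Nat.card {T : SimpleGraph V // T ≤ G ∧ T.IsTree} := by
  rw [(ofSimpleGraph G).card_sinkSandpileGroup s fun v =>
      (reachable_ofSimpleGraph_iff G v s).2 (hconn.preconnected v s), card_arborescencesTo_ofSimpleGraph]

end Multidigraph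

end Literature.Combinatorics.Digraph
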